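import Summits.CriticalPhenomena.Ising3D.Control2DOpeEpsTail
import Summits.CriticalPhenomena.Ising3D.Control2DOpeTailKernel
import Summits.CriticalPhenomena.Ising3D.Control2DPolyCertAuto
import Mathlib.Tactic.Linarith
import Mathlib.Tactic.Positivity
import Mathlib.Tactic.FieldSimp
import Mathlib.Tactic.Ring
import Mathlib.Tactic.LinearCombination
import HarnessLib

/-!
# Kind `ope2eps` from KERNEL data: the three box leaves (sign upper, (I″), sign lower with the integer tail) as Bernstein decisions
(cell `pub-ising3x`, seat controls-1 gen 21; KERNEL PATH for the 2D γ-certificates, kind `ope2eps` (the `λ²_σσε` datum) — CONTROL-ONLY)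

HONEST FRAMING: lottery ticket; floor = tightest certified 3D Ising CFT bounds; no exact-solution
claim without a proof. CONTROL-ONLY (`d = 2`, `Δ_σ = 1/8`, axiom set `A2D′`); nothing numerical is asserted here.

`Control2DOpeEpsCells` (a sibling of this file; both import `Control2DOpeEpsTail`) reduces both senses of kind `ope2eps` to the cells record `OpeEpsCellsN`, (R), and per `ε`-box cell three
statements about the TRUNCATED scalar block `Q_{Nd+1}(Δ,0)` of the table functional `φ` (`Δ = 2y`, `y` = the cell variable of the
spin-0 cell polynomial `P̂₀ = cellPolyZ wt Sl Λ 0 Nd`, `P̂₀(y) = cellConst Λ 0 Nd Δ · φ[F_-[Q_{Nd+1}(Δ,0)]]`,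
`cellConst = 8^Λ Λ!² 4^{Nd} D₀(y)² / ((1/2)^{1/4} (1/2)^Δ)`, `D₀ = denProd Nd 0`):
* UPPER sign `0 < φ[F_-[Q(Δ,0)]]` ⇐ `P̂₀(y) - 1 ≥ 0` — `epsSignUpper_of_bernAuto_trunc`;
* (I″) `0 < φ[F_-[1]] + (Pn/Pd)·2^Δ φ[F_-[Q(Δ,0)]]` ⇐ `Pd·identZ·4^{Nd}·D₀(y)² + Pn·P̂₀(y) - 1 ≥ 0` (`2^Δ (1/2)^Δ = 1` removes every
  irrational factor but the common `(1/2)^{1/4}`) — `epsIdent_of_bernAuto_trunc`, with `D₀(y)² = (dpolyZ Nd)²`, `dpolyZ Nd = zprodRange (denZ 0) Nd`;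
* LOWER sign with the integer tail: `2^Δ φ[F_-[Q(Δ,0)]] + (1/2)^{1/4}·2W·σ_N(2S_N+σ_N) ≤ -σ` ⇐ `-(c₁·P̂₀(y) + K·D₀(y)²) - 1 ≥ 0`, `N = Nd+1`,
  `d = N+3-Λ`, `c₁ = 4^N d²`, `A = 2(N+3)·C(N+Λ+2, Λ)`, `H = Σ_{m<N} 2^{N-m} C(m+Λ+2, Λ)` (`headMajor Λ N = H/2^N`,
  `σ_N = A/(2^N d)`), `K = 8^Λ Λ!² 4^{Nd} · 2W · A (2Hd + A)`, margin `σ = (1/2)^{1/4} / (8^Λ Λ!² 4^{Nd} c₁ D₀(y₂)²)` at the cell's right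
  end `y₂` (`D₀` is monotone) — `epsSignLower_of_bernAuto_trunc`.
Each `⇐` is ONE `bernAuto (ptrunc <integer list> m) q a L = true` the kernel decides on the literal `P̂₀` a replay materialises (the truncation
bounds the exact polynomial from below on `y ≥ 0`, `pow_mul_evalR_ptrunc_le`). The generator branch (`kind ope2eps`) and the replays of the
RB-6 `ope2eps` certificates (Λ 11 / 15, readers A ∧ B PASS) are the successor's: they chain these leaves over the box and call
`opeEpsUpper_half_of_cellsN` / `opeEpsLower_half_of_cellsN`. PROVED; no facts, standard axioms only. [cite: RattazziEtAl2008, §5]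
-/

namespace Summit.CriticalPhenomena.Ising3D.Control2D

open Finset Set
open Literature.Analysis.ValidatedNumerics.PolyMP
open Literature.MathematicalPhysics.QuantumFieldTheory.ConformalBootstrap3D

/-! ### The spin-0 normalisation at `Δ = 2y` and the denominator polynomial -/

/-- The spin-0 denominator product `D₀(y) = ∏_{i<Nd} den⁰_i(y)` as an integer coefficient list. [folklore] -/
def dpolyZ (Nd : ℕ) : List ℤ := zprodRange (denZ 0) Nd

/-- [folklore] -/
theorem evalR_dpolyZ (Nd : ℕ) (y : ℝ) : evalR (castZ (dpolyZ Nd)) y = denProd Nd 0 y := by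
  rw [dpolyZ, evalR_zprodRange]; rfl

/-- `D₀` is monotone on `y ≥ 0` (every factor `2`, `(i+1)(2y+i)` is non-negative and non-decreasing). [folklore] -/
theorem denProd_zero_mono (Nd : ℕ) {y y' : ℝ} (hy : 0 ≤ y) (hyy : y ≤ y') : denProd Nd 0 y ≤ denProd Nd 0 y' := by
  unfold denProd
  refine Finset.prod_le_prod (fun i _ => (evalR_denZ_pos 0 i (by push_cast; linarith)).le) fun i _ => ?_
  rw [evalR_denZ, evalR_denZ]
  split_ifs
  · exact le_rfl
  · push_cast
    have : (0 : ℝ) ≤ i := Nat.cast_nonneg i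
    nlinarith

/-- **`2^Δ φ[F_-[Q_{Nd+1}(Δ,0)]]` in terms of the spin-0 cell polynomial**: with `y = Δ/2 ≥ 0`,
`8^Λ Λ!² 4^{Nd} D₀(y)² · (2^Δ φ[F^{1/8}_-[Q_{Nd+1}(Δ,0)]]) = (1/2)^{1/8}(1/2)^{1/8} · P̂₀(y)`. [folklore] -/
theorem two_rpow_mul_phiQ_eq (wt : ℕ × ℕ → ℤ) {Sl : List (ℕ × ℕ)} (hnd : Sl.Nodup) {Λ : ℕ}
    (hΛ : ∀ p ∈ Sl, p.1 + p.2 ≤ Λ) (Nd : ℕ) {Δ : ℝ} (hΔ : 0 ≤ Δ) :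
    8 ^ Λ * (Λ.factorial : ℝ) * (Λ.factorial : ℝ) * (4 : ℝ) ^ Nd * (denProd Nd 0 (Δ / 2)) ^ 2 *
        ((2 : ℝ) ^ Δ * taylorFunctional2D (1 / 2) Sl.toFinset (fun p => (wt p : ℝ)) (crossF (1 / 8) (-1) (QN (Nd + 1) 0 Δ))) =
      (1 / 2 : ℝ) ^ (1 / 8 : ℝ) * (1 / 2 : ℝ) ^ (1 / 8 : ℝ) * evalR (castZ (cellPolyZ wt Sl Λ 0 Nd)) (Δ / 2) := by
  have h := evalR_cellPolyZ wt hnd hΛ 0 Nd (Δ := Δ) (by simpa using hΔ)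
  have h0 : (Δ - ((0 : ℕ) : ℝ)) / 2 = Δ / 2 := by simp
  rw [h0] at h
  have hc2 : (0 : ℝ) < (1 / 2 : ℝ) ^ (1 / 8 : ℝ) := Real.rpow_pos_of_pos (by norm_num) _
  have hhalf : (0 : ℝ) < (1 / 2 : ℝ) ^ Δ := Real.rpow_pos_of_pos (by norm_num) _
  have hD : 0 < denProd Nd 0 (Δ / 2) := denProd_pos Nd 0 (by push_cast; linarith)
  have hone : (2 : ℝ) ^ Δ * (1 / 2 : ℝ) ^ Δ = 1 := by
    rw [← Real.mul_rpow (by norm_num) (by norm_num)]; norm_num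
  set φT := taylorFunctional2D (1 / 2) Sl.toFinset (fun p => (wt p : ℝ)) (crossF (1 / 8) (-1) (QN (Nd + 1) 0 Δ)) with hφT
  set Pv := evalR (castZ (cellPolyZ wt Sl Λ 0 Nd)) (Δ / 2) with hPv
  set c2 : ℝ := (1 / 2 : ℝ) ^ (1 / 8 : ℝ) * (1 / 2 : ℝ) ^ (1 / 8 : ℝ) with hc2d
  -- `c2 (1/2)^Δ P̂₀ = 8^Λ Λ!² 4^Nd D D φ`
  have h' : c2 * (1 / 2 : ℝ) ^ Δ * Pv = 8 ^ Λ * (Λ.factorial : ℝ) * (Λ.factorial : ℝ) * (4 : ℝ) ^ Nd *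
      denProd Nd 0 (Δ / 2) * denProd Nd 0 (Δ / 2) * φT := by
    rw [h, hc2d]
    unfold cellConst
    rw [h0]
    field_simp
  linear_combination (-(2 : ℝ) ^ Δ) * h' + (c2 * Pv) * hone

/-- The cell variable `y = Δ/2` lies in `[a/q, (a+L)/q]` when `Δ ∈ [2a/q, 2(a+L)/q]`. [folklore] -/
theorem half_mem_cell {q a L : ℤ} (hq : 0 < q) {Δ : ℝ} (hlo : 2 * (a : ℝ) / q ≤ Δ) (hhi : Δ ≤ 2 * ((a : ℝ) + L) / q) :
    (a : ℝ) / q ≤ Δ / 2 ∧ Δ / 2 ≤ ((a : ℝ) + L) / q := by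
  have hqR : (0 : ℝ) < q := by exact_mod_cast hq
  have h1 := (div_le_iff₀ hqR).mp hlo
  have h2 := (le_div_iff₀ hqR).mp hhi
  constructor
  · rw [div_le_div_iff₀ hqR two_pos]; linarith
  · rw [div_le_div_iff₀ two_pos hqR]; linarith

/-- From a truncated Bernstein decision to the exact polynomial inequality `p(y) ≥ 0` on the cell (`y ≥ 0`). [folklore] -/
theorem evalR_nonneg_of_bernAuto_trunc {p : List ℤ} {m : ℕ} {q a L : ℤ} (hq : 0 < q) (ha : 0 ≤ a) (hL : 0 ≤ L)
    (hchk : bernAuto (ptrunc p m) q a L = true) {y : ℝ} (hlo : (a : ℝ) / q ≤ y) (hhi : y ≤ ((a : ℝ) + L) / q) :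
    0 ≤ evalR (castZ p) y := by
  have hqR : (0 : ℝ) < q := by exact_mod_cast hq
  have hy : 0 ≤ y := le_trans (by positivity) hlo
  have h := evalR_nonneg_of_bernAuto hq hL hchk hlo hhi
  have hle := pow_mul_evalR_ptrunc_le m hy p
  have hM : (0 : ℝ) < (10 : ℝ) ^ m := by positivity
  nlinarith [hle, mul_nonneg hM.le h]

/-! ### Leaf 1: the UPPER sign -/

/-- **UPPER sign leaf**: `bernAuto (ptrunc (P̂₀ - 1) m) q a L = true` gives `0 < φ[F_-[Q_{Nd+1}(Δ,0)]]` for `2a/q ≤ Δ ≤ 2(a+L)/q`. [folklore] -/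
theorem epsSignUpper_of_bernAuto_trunc (wt : ℕ × ℕ → ℤ) {Sl : List (ℕ × ℕ)} (hnd : Sl.Nodup) {Λ : ℕ}
    (hΛ : ∀ p ∈ Sl, p.1 + p.2 ≤ Λ) (Nd m : ℕ) {q a L : ℤ} (hq : 0 < q) (ha : 0 ≤ a) (hL : 0 ≤ L)
    (hchk : bernAuto (ptrunc (zadd (cellPolyZ wt Sl Λ 0 Nd) [-1]) m) q a L = true) {Δ : ℝ}
    (hlo : 2 * (a : ℝ) / q ≤ Δ) (hhi : Δ ≤ 2 * ((a : ℝ) + L) / q) :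
    0 < taylorFunctional2D (1 / 2) Sl.toFinset (fun p => (wt p : ℝ)) (crossF (1 / 8) (-1) (QN (Nd + 1) 0 Δ)) := by
  have hqR : (0 : ℝ) < q := by exact_mod_cast hq
  have hΔ : 0 ≤ Δ := le_trans (by positivity) hlo
  obtain ⟨hylo, hyhi⟩ := half_mem_cell hq hlo hhi
  have h := evalR_nonneg_of_bernAuto_trunc hq ha hL hchk (y := Δ / 2) hylo hyhi
  rw [evalR_zadd] at h
  have hP : 1 ≤ evalR (castZ (cellPolyZ wt Sl Λ 0 Nd)) (Δ / 2) := by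
    have : evalR (castZ [-1]) (Δ / 2) = -1 := by simp
    linarith [this ▸ h]
  have hkey := two_rpow_mul_phiQ_eq wt hnd hΛ Nd hΔ
  have hc2 : (0 : ℝ) < (1 / 2 : ℝ) ^ (1 / 8 : ℝ) := Real.rpow_pos_of_pos (by norm_num) _
  have hD : 0 < denProd Nd 0 (Δ / 2) := denProd_pos Nd 0 (by push_cast; linarith)
  have h2Δ : (0 : ℝ) < (2 : ℝ) ^ Δ := Real.rpow_pos_of_pos (by norm_num) _
  have hM : (0 : ℝ) < 8 ^ Λ * (Λ.factorial : ℝ) * (Λ.factorial : ℝ) * (4 : ℝ) ^ Nd * (denProd Nd 0 (Δ / 2)) ^ 2 := by positivity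
  have hpos : 0 < 8 ^ Λ * (Λ.factorial : ℝ) * (Λ.factorial : ℝ) * (4 : ℝ) ^ Nd * (denProd Nd 0 (Δ / 2)) ^ 2 *
      ((2 : ℝ) ^ Δ * taylorFunctional2D (1 / 2) Sl.toFinset (fun p => (wt p : ℝ)) (crossF (1 / 8) (-1) (QN (Nd + 1) 0 Δ))) := by
    rw [hkey]; positivity
  have := (mul_pos_iff_of_pos_left hM).mp hpos
  exact (mul_pos_iff_of_pos_left h2Δ).mp this

/-! ### Leaf 2: (I″) -/

/-- The (I″) polynomial `Pd·identZ·4^{Nd}·D₀(y)² + Pn·P̂₀(y)`. [folklore] -/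
def epsIdentPolyZ (wt : ℕ × ℕ → ℤ) (Sl : List (ℕ × ℕ)) (Λ Nd Pn Pd : ℕ) : List ℤ :=
  zadd (zsmul ((Pd : ℤ) * identZ wt Sl Λ * 4 ^ Nd) (zmul (dpolyZ Nd) (dpolyZ Nd))) (zsmul (Pn : ℤ) (cellPolyZ wt Sl Λ 0 Nd))

/-- **(I″) leaf**: `bernAuto (ptrunc (epsIdentPolyZ - 1) m) q a L = true` gives
`0 < φ[F_-[1]] + (Pn/Pd)·(2^Δ φ[F_-[Q_{Nd+1}(Δ,0)]])` for `2a/q ≤ Δ ≤ 2(a+L)/q` (`Pd > 0`). [folklore] -/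
theorem epsIdent_of_bernAuto_trunc (wt : ℕ × ℕ → ℤ) {Sl : List (ℕ × ℕ)} (hnd : Sl.Nodup) {Λ : ℕ}
    (hΛ : ∀ p ∈ Sl, p.1 + p.2 ≤ Λ) (Nd m : ℕ) {Pn Pd : ℕ} (hPd : 0 < Pd) {q a L : ℤ} (hq : 0 < q) (ha : 0 ≤ a) (hL : 0 ≤ L)
    (hchk : bernAuto (ptrunc (zadd (epsIdentPolyZ wt Sl Λ Nd Pn Pd) [-1]) m) q a L = true) {Δ : ℝ}
    (hlo : 2 * (a : ℝ) / q ≤ Δ) (hhi : Δ ≤ 2 * ((a : ℝ) + L) / q) :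
    0 < taylorFunctional2D (1 / 2) Sl.toFinset (fun p => (wt p : ℝ)) (crossF (1 / 8) (-1) (fun _ _ => (1 : ℝ))) +
      ((Pn : ℝ) / Pd) * ((2 : ℝ) ^ Δ *
        taylorFunctional2D (1 / 2) Sl.toFinset (fun p => (wt p : ℝ)) (crossF (1 / 8) (-1) (QN (Nd + 1) 0 Δ))) := by
  have hqR : (0 : ℝ) < q := by exact_mod_cast hq
  have hΔ : 0 ≤ Δ := le_trans (by positivity) hlo
  obtain ⟨hylo, hyhi⟩ := half_mem_cell hq hlo hhi
  have h := evalR_nonneg_of_bernAuto_trunc hq ha hL hchk (y := Δ / 2) hylo hyhi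
  rw [evalR_zadd, epsIdentPolyZ, evalR_zadd, evalR_zsmul, evalR_zsmul, evalR_zmul, evalR_dpolyZ] at h
  have hm1 : evalR (castZ [-1]) (Δ / 2) = -1 := by simp
  rw [hm1] at h
  set φ1 := taylorFunctional2D (1 / 2) Sl.toFinset (fun p => (wt p : ℝ)) (crossF (1 / 8) (-1) (fun _ _ => (1 : ℝ))) with hφ1
  set X := (2 : ℝ) ^ Δ * taylorFunctional2D (1 / 2) Sl.toFinset (fun p => (wt p : ℝ)) (crossF (1 / 8) (-1) (QN (Nd + 1) 0 Δ)) with hX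
  set c2 : ℝ := (1 / 2 : ℝ) ^ (1 / 8 : ℝ) * (1 / 2 : ℝ) ^ (1 / 8 : ℝ) with hc2
  have hc2pos : 0 < c2 := by
    have : (0 : ℝ) < (1 / 2 : ℝ) ^ (1 / 8 : ℝ) := Real.rpow_pos_of_pos (by norm_num) _
    rw [hc2]; positivity
  have hD : 0 < denProd Nd 0 (Δ / 2) := denProd_pos Nd 0 (by push_cast; linarith)
  have hPdR : (0 : ℝ) < Pd := by exact_mod_cast hPd
  -- (I): `regConst · φ1 = c2 · identZ`; the block: `regConst·4^Nd·D₀²·X = c2·P̂₀(y)`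
  have h1 : regConst Λ * φ1 = c2 * (identZ wt Sl Λ : ℝ) := regConst_mul_taylorFunctional2D_one wt hnd hΛ
  have h2 := two_rpow_mul_phiQ_eq wt hnd hΛ Nd hΔ
  rw [← hX] at h2
  have key : regConst Λ * (4 : ℝ) ^ Nd * (denProd Nd 0 (Δ / 2)) ^ 2 * (Pd : ℝ) * (φ1 + ((Pn : ℝ) / Pd) * X) =
      c2 * (((((Pd : ℤ) * identZ wt Sl Λ * 4 ^ Nd : ℤ)) : ℝ) * (denProd Nd 0 (Δ / 2) * denProd Nd 0 (Δ / 2)) +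
        ((Pn : ℤ) : ℝ) * evalR (castZ (cellPolyZ wt Sl Λ 0 Nd)) (Δ / 2)) := by
    unfold regConst at h1 ⊢
    push_cast
    field_simp
    linear_combination ((4 : ℝ) ^ Nd * (denProd Nd 0 (Δ / 2)) ^ 2 * (Pd : ℝ)) * h1 + (Pn : ℝ) * h2
  have hM : 0 < regConst Λ * (4 : ℝ) ^ Nd * (denProd Nd 0 (Δ / 2)) ^ 2 * (Pd : ℝ) := by
    have := regConst_pos Λ; positivity
  have hrhs : 0 < c2 * (((((Pd : ℤ) * identZ wt Sl Λ * 4 ^ Nd : ℤ)) : ℝ) * (denProd Nd 0 (Δ / 2) * denProd Nd 0 (Δ / 2)) +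
        ((Pn : ℤ) : ℝ) * evalR (castZ (cellPolyZ wt Sl Λ 0 Nd)) (Δ / 2)) := mul_pos hc2pos (by linarith)
  rw [← key] at hrhs
  exact (mul_pos_iff_of_pos_left hM).mp hrhs

/-! ### Leaf 3: the LOWER sign with the integer tail -/

/-- `H = Σ_{m<N} 2^{N-m} C(m+Λ+2, Λ)` (so `headMajor Λ N = H / 2^N`). [folklore] -/
def headMajorZ (Λ N : ℕ) : ℕ := ∑ m ∈ range N, 2 ^ (N - m) * (m + Λ + 2).choose Λ

/-- [folklore] -/
theorem headMajor_eq (Λ N : ℕ) : headMajor Λ N = (headMajorZ Λ N : ℝ) / 2 ^ N := by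
  rw [headMajor, headMajorZ, Nat.cast_sum, Finset.sum_div]
  refine Finset.sum_congr rfl fun m hm => ?_
  have hmN : m ≤ N := (Finset.mem_range.mp hm).le
  push_cast
  rw [one_div_pow, show (2 : ℝ) ^ N = 2 ^ (N - m) * 2 ^ m by rw [← pow_add, Nat.sub_add_cancel hmN]]
  field_simp

/-- The kernel's version of `H` by structural recursion (`Finset` folds are kernel-hostile): `Σ_{m<k} 2^{N-m} C(m+Λ+2,Λ)` with `C` through
`descFactorial / Λ!`. [folklore] -/
def headMajorK (Λ N : ℕ) : ℕ → ℕ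
  | 0 => 0
  | k + 1 => headMajorK Λ N k + 2 ^ (N - k) * ((k + Λ + 2).descFactorial Λ / Λ.factorial)

/-- [folklore] -/
theorem headMajorK_eq (Λ N : ℕ) : ∀ k : ℕ, headMajorK Λ N k = ∑ m ∈ range k, 2 ^ (N - m) * (m + Λ + 2).choose Λ
  | 0 => by simp [headMajorK]
  | k + 1 => by rw [headMajorK, headMajorK_eq Λ N k, sum_range_succ, Nat.choose_eq_descFactorial_div_factorial]

/-- `A = 2(N+3)·C(N+Λ+2, Λ)` (`N = Nd+1`; `σ_N = A/(2^N d)`), with `C` through `descFactorial / Λ!`. [folklore] -/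
def epsA (Λ Nd : ℕ) : ℕ := 2 * (Nd + 1 + 3) * ((Nd + 1 + Λ + 2).descFactorial Λ / Λ.factorial)

/-- `c₁ = 4^N d²`, `d = N+3-Λ`. [folklore] -/
def epsC1 (Λ Nd : ℕ) : ℕ := 4 ^ (Nd + 1) * (Nd + 1 + 3 - Λ) ^ 2

/-- The integer tail constant `K = 8^Λ Λ!² 4^{Nd} · 2 · A (2Hd + A) · W`. [folklore] -/
def epsKZ (wt : ℕ × ℕ → ℤ) (Sl : List (ℕ × ℕ)) (Λ Nd : ℕ) : ℤ :=
  ((8 ^ Λ * Λ.factorial * Λ.factorial * 4 ^ Nd * 2 *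
      (epsA Λ Nd * (2 * headMajorK Λ (Nd + 1) (Nd + 1) * (Nd + 1 + 3 - Λ) + epsA Λ Nd)) : ℕ) : ℤ) * wabsZ wt Sl

/-- The LOWER sign polynomial `-(c₁ P̂₀ + K D₀²)`. [folklore] -/
def epsLowerPolyZ (wt : ℕ × ℕ → ℤ) (Sl : List (ℕ × ℕ)) (Λ Nd : ℕ) : List ℤ :=
  zadd (zsmul (-((epsC1 Λ Nd : ℕ) : ℤ)) (cellPolyZ wt Sl Λ 0 Nd)) (zsmul (-(epsKZ wt Sl Λ Nd)) (zmul (dpolyZ Nd) (dpolyZ Nd)))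

/-- The uniform margin of the LOWER sign leaf on a cell with right end `y₂`: `σ = (1/2)^{1/4} / (8^Λ Λ!² 4^{Nd} · c₁ · D₀(y₂)²)`. [folklore] -/
noncomputable def epsLowerMargin (Λ Nd : ℕ) (y₂ : ℝ) : ℝ :=
  (1 / 2 : ℝ) ^ (1 / 8 : ℝ) * (1 / 2 : ℝ) ^ (1 / 8 : ℝ) /
    (8 ^ Λ * (Λ.factorial : ℝ) * (Λ.factorial : ℝ) * (4 : ℝ) ^ Nd * ((epsC1 Λ Nd : ℕ) : ℝ) * (denProd Nd 0 y₂) ^ 2)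

/-- [folklore] -/
theorem epsC1_pos {Λ Nd : ℕ} (hΛ : Λ < Nd + 4) : 0 < epsC1 Λ Nd := by
  unfold epsC1
  have : 0 < Nd + 1 + 3 - Λ := by omega
  positivity

/-- [folklore] -/
theorem epsLowerMargin_pos (Λ Nd : ℕ) {y₂ : ℝ} (hy : 0 ≤ y₂) (hΛ : Λ < Nd + 4) : 0 < epsLowerMargin Λ Nd y₂ := by
  unfold epsLowerMargin
  have hc2 : (0 : ℝ) < (1 / 2 : ℝ) ^ (1 / 8 : ℝ) := Real.rpow_pos_of_pos (by norm_num) _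
  have hD : 0 < denProd Nd 0 y₂ := denProd_pos Nd 0 (by push_cast; linarith)
  have hd : (0 : ℝ) < ((epsC1 Λ Nd : ℕ) : ℝ) := by exact_mod_cast epsC1_pos hΛ
  positivity

/-- The margin is antitone in the right end: a cover of the box by several cells may use the margin at `e₂/2`. [folklore] -/
theorem epsLowerMargin_anti (Λ Nd : ℕ) {y y' : ℝ} (hy : 0 ≤ y) (hyy : y ≤ y') (hΛ : Λ < Nd + 4) :
    epsLowerMargin Λ Nd y' ≤ epsLowerMargin Λ Nd y := by
  unfold epsLowerMargin
  have hc2 : (0 : ℝ) < (1 / 2 : ℝ) ^ (1 / 8 : ℝ) := Real.rpow_pos_of_pos (by norm_num) _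
  have hD : 0 < denProd Nd 0 y := denProd_pos Nd 0 (by push_cast; linarith)
  have hDm : denProd Nd 0 y ≤ denProd Nd 0 y' := denProd_zero_mono Nd hy hyy
  have hd : (0 : ℝ) < ((epsC1 Λ Nd : ℕ) : ℝ) := by exact_mod_cast epsC1_pos hΛ
  have hsq : (denProd Nd 0 y) ^ 2 ≤ (denProd Nd 0 y') ^ 2 := pow_le_pow_left₀ hD.le hDm 2
  exact div_le_div_of_nonneg_left (by positivity) (by positivity) (mul_le_mul_of_nonneg_left hsq (by positivity))

set_option maxHeartbeats 800000 in
/-- **LOWER sign leaf with the integer tail**: `bernAuto (ptrunc (epsLowerPolyZ - 1) m) q a L = true` (`q > 0`, `a ≥ 0`, `L ≥ 0`, `Λ < Nd + 4`)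
gives, for every `Δ` with `2a/q ≤ Δ ≤ 2(a+L)/q`, the sign check of `opeEpsLower_half_of_cellsN` with the margin at the cell's right end:
`2^Δ φ[F_-[Q_{Nd+1}(Δ,0)]] + (1/2)^{1/8}(1/2)^{1/8}·2W·σ_N(2S_N+σ_N) ≤ -epsLowerMargin Λ Nd ((a+L)/q)`,
`N = Nd + 1`, `σ_N = 4·tailMajor Λ (N+2)`, `S_N = headMajor Λ N`. [folklore] -/
theorem epsSignLower_of_bernAuto_trunc (wt : ℕ × ℕ → ℤ) {Sl : List (ℕ × ℕ)} (hnd : Sl.Nodup) {Λ : ℕ}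
    (hΛ : ∀ p ∈ Sl, p.1 + p.2 ≤ Λ) (Nd m : ℕ) (hΛN : Λ < Nd + 4) {q a L : ℤ} (hq : 0 < q) (ha : 0 ≤ a) (hL : 0 ≤ L)
    (hchk : bernAuto (ptrunc (zadd (epsLowerPolyZ wt Sl Λ Nd) [-1]) m) q a L = true) {Δ : ℝ}
    (hlo : 2 * (a : ℝ) / q ≤ Δ) (hhi : Δ ≤ 2 * ((a : ℝ) + L) / q) :
    (2 : ℝ) ^ Δ * taylorFunctional2D (1 / 2) Sl.toFinset (fun p => (wt p : ℝ)) (crossF (1 / 8) (-1) (QN (Nd + 1) 0 Δ)) +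
        (1 / 2 : ℝ) ^ (1 / 8 : ℝ) * (1 / 2 : ℝ) ^ (1 / 8 : ℝ) * (2 * absWeight Sl.toFinset (fun p => (wt p : ℝ))) *
          ((4 * tailMajor Λ (Nd + 1 + 2)) * (2 * headMajor Λ (Nd + 1) + 4 * tailMajor Λ (Nd + 1 + 2))) ≤
      -epsLowerMargin Λ Nd (((a : ℝ) + L) / q) := by
  have hqR : (0 : ℝ) < q := by exact_mod_cast hq
  have hΔ : 0 ≤ Δ := le_trans (by positivity) hlo
  obtain ⟨hylo, hyhi⟩ := half_mem_cell hq hlo hhi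
  have h := evalR_nonneg_of_bernAuto_trunc hq ha hL hchk (y := Δ / 2) hylo hyhi
  rw [evalR_zadd] at h
  have hm1 : evalR (castZ [-1]) (Δ / 2) = -1 := by simp
  rw [hm1] at h
  -- atoms
  set Pv := evalR (castZ (cellPolyZ wt Sl Λ 0 Nd)) (Δ / 2) with hPv
  set DD := denProd Nd 0 (Δ / 2) * denProd Nd 0 (Δ / 2) with hDD
  set c1 : ℝ := ((epsC1 Λ Nd : ℕ) : ℝ) with hc1
  set Kr : ℝ := ((epsKZ wt Sl Λ Nd : ℤ) : ℝ) with hKr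
  set c2 : ℝ := (1 / 2 : ℝ) ^ (1 / 8 : ℝ) * (1 / 2 : ℝ) ^ (1 / 8 : ℝ) with hc2def
  set Wr := absWeight Sl.toFinset (fun p => (wt p : ℝ)) with hWr
  set X := (2 : ℝ) ^ Δ * taylorFunctional2D (1 / 2) Sl.toFinset (fun p => (wt p : ℝ)) (crossF (1 / 8) (-1) (QN (Nd + 1) 0 Δ)) with hX
  set Tr := c2 * (2 * Wr) * ((4 * tailMajor Λ (Nd + 1 + 2)) * (2 * headMajor Λ (Nd + 1) + 4 * tailMajor Λ (Nd + 1 + 2))) with hTr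
  have hev : evalR (castZ (epsLowerPolyZ wt Sl Λ Nd)) (Δ / 2) = -c1 * Pv - Kr * DD := by
    rw [epsLowerPolyZ, evalR_zadd, evalR_zsmul, evalR_zsmul, evalR_zmul, evalR_dpolyZ, hc1, hKr, hPv, hDD]
    push_cast
    ring
  rw [hev] at h
  -- positivity of the atoms
  have hc2pos : 0 < c2 := by
    have : (0 : ℝ) < (1 / 2 : ℝ) ^ (1 / 8 : ℝ) := Real.rpow_pos_of_pos (by norm_num) _
    rw [hc2def]; positivity
  have hD : 0 < denProd Nd 0 (Δ / 2) := denProd_pos Nd 0 (by push_cast; linarith)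
  have hDm : denProd Nd 0 (Δ / 2) ≤ denProd Nd 0 (((a : ℝ) + L) / q) := denProd_zero_mono Nd (by linarith) hyhi
  have hc1pos : 0 < c1 := by rw [hc1]; exact_mod_cast epsC1_pos hΛN
  have hdpos : 0 < Nd + 1 + 3 - Λ := by omega
  have hdR : (((Nd + 1 + 3 - Λ : ℕ)) : ℝ) = (Nd : ℝ) + 1 + 3 - Λ := by
    rw [Nat.cast_sub (by omega)]; push_cast; ring
  set M1 : ℝ := 8 ^ Λ * (Λ.factorial : ℝ) * (Λ.factorial : ℝ) * (4 : ℝ) ^ Nd * DD with hM1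
  have hM1pos : 0 < M1 := by rw [hM1, hDD]; positivity
  -- the block identity `M1 · X = c2 · P̂₀(y)`
  have hQ : M1 * X = c2 * Pv := by
    have hkey := two_rpow_mul_phiQ_eq wt hnd hΛ Nd hΔ
    rw [pow_two] at hkey
    rw [hM1, hDD, hX, hc2def, hPv]
    linear_combination hkey
  -- the tail identity `M1 · Tr · c1 = c2 · Kr · DD`
  have hW := cast_wabsZ wt hnd
  have hσ : 4 * tailMajor Λ (Nd + 1 + 2) = ((epsA Λ Nd : ℕ) : ℝ) / (2 ^ (Nd + 1) * (((Nd + 1 + 3 - Λ : ℕ)) : ℝ)) := by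
    rw [tailMajor, epsA, ← Nat.choose_eq_descFactorial_div_factorial, hdR, one_div_pow, pow_add]
    have hd0 : ((Nd + 1 + 2 : ℕ) : ℝ) + 1 - Λ = (Nd : ℝ) + 1 + 3 - Λ := by push_cast; ring
    have hd1 : ((Nd + 1 + 2 : ℕ) : ℝ) + 1 = (Nd : ℝ) + 1 + 3 := by push_cast; ring
    have hne : (Nd : ℝ) + 1 + 3 - Λ ≠ 0 := by rw [← hdR]; exact_mod_cast hdpos.ne'
    rw [hd0, hd1, show Nd + 1 + 2 + Λ = Nd + 1 + Λ + 2 by ring]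
    push_cast
    field_simp
    ring
  have hH : headMajor Λ (Nd + 1) = ((headMajorK Λ (Nd + 1) (Nd + 1) : ℕ) : ℝ) / 2 ^ (Nd + 1) := by
    rw [headMajor_eq, headMajorK_eq, headMajorZ]
  have hT : M1 * Tr * c1 = c2 * Kr * DD := by
    rw [hTr, hσ, hH, hM1, hKr, hc1, hWr, ← hW, epsKZ, epsC1]
    have hd0 : ((((Nd + 1 + 3 - Λ : ℕ)) : ℝ)) ≠ 0 := by exact_mod_cast hdpos.ne'
    have h4 : (4 : ℝ) ^ (Nd + 1) = 2 ^ (Nd + 1) * 2 ^ (Nd + 1) := by rw [← mul_pow]; norm_num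
    push_cast
    rw [h4]
    field_simp
  -- `h : 0 ≤ -c1 Pv - Kr DD - 1` ⇒ `M1 (X + Tr) c1 = c2 (c1 Pv + Kr DD) ≤ -c2`
  have hsum : M1 * (X + Tr) * c1 ≤ -c2 := by
    have h3 : c1 * Pv + Kr * DD ≤ -1 := by linarith
    have h4 : M1 * (X + Tr) * c1 = c2 * (c1 * Pv + Kr * DD) := by
      calc M1 * (X + Tr) * c1 = c1 * (M1 * X) + M1 * Tr * c1 := by ring
        _ = c1 * (c2 * Pv) + c2 * Kr * DD := by rw [hQ, hT]
        _ = c2 * (c1 * Pv + Kr * DD) := by ring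
    rw [h4]
    have h5 := mul_le_mul_of_nonneg_left h3 hc2pos.le
    linarith
  have hle1 : X + Tr ≤ -c2 / (M1 * c1) := by
    rw [le_div_iff₀ (mul_pos hM1pos hc1pos)]
    nlinarith [hsum]
  -- the margin at `Δ/2` dominates the one at the right end `y₂`
  have hmargin : epsLowerMargin Λ Nd (((a : ℝ) + L) / q) ≤ c2 / (M1 * c1) := by
    unfold epsLowerMargin
    rw [← hc2def, ← hc1, hM1, hDD]
    have hD2 : 0 < denProd Nd 0 (((a : ℝ) + L) / q) := lt_of_lt_of_le hD hDm
    rw [div_le_div_iff₀ (by positivity) (by positivity)]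
    have hsq : denProd Nd 0 (Δ / 2) * denProd Nd 0 (Δ / 2) ≤ (denProd Nd 0 (((a : ℝ) + L) / q)) ^ 2 := by
      rw [pow_two]; exact mul_le_mul hDm hDm hD.le hD2.le
    have hrest : 0 ≤ c2 * (8 ^ Λ * (Λ.factorial : ℝ) * (Λ.factorial : ℝ) * (4 : ℝ) ^ Nd * c1) := by positivity
    nlinarith [mul_le_mul_of_nonneg_left hsq hrest]
  have hneg : -c2 / (M1 * c1) = -(c2 / (M1 * c1)) := neg_div _ _
  rw [hneg] at hle1
  linarith

end Summit.CriticalPhenomena.Ising3D.Control2D
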